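import Summits.Ventures.Crystal3D.Theorems.StickyWulffConstantNoReconstructionGainGrainFrameSplA
import HarnessLib

/-!
# The single-point blocking lemma behind the cap budget for two contacts — remaining faces and assembly

HONEST FRAMING. Part of the venture `Summits/Ventures/Crystal3D` (cell `crystal3d-full`), helper
`--supports` the crux `NoReconstructionGain` (stmt-Ventures-19144, route
`route-Ventures-StickyWulffConstant`), line `adhesion` (wulff-p1 g11); second half of `…GrainFrameSplA`
(see there for the coordinates and the statement): the squares about `+x`, `−x`, `−y`, `−z`, the
triangular faces, and the assembled lemma `spl2_coords` — a contact direction strictly deeper than the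
second-deepest star direction, other than the deepest star direction itself, blocks two distinct
strictly-down star directions.

WHAT THIS IS NOT: the three-contact case; rung F-C1 not moved.
-/

namespace Summit.Ventures.Crystal3D.Theorems

section spl
variable {a b c x y z : ℝ} (ha : 0 ≤ a) (hab : a ≤ b) (hbc : b ≤ c)
  (hS : a ^ 2 + b ^ 2 + c ^ 2 = 2) (hu : x ^ 2 + y ^ 2 + z ^ 2 = 2)
  (hdc : a + c < a * x + b * y + c * z)
include ha hab hbc hS hu hdc

set_option maxHeartbeats 400000 in
/-- Face `x ≥ |y| + |z|` (the square about `+x`). -/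
theorem spl2_sqPosX (hF : |y| + |z| ≤ x) : 1 < x + y ∧ 1 < x + z ∧ 0 < a + b := by
  have hc : 0 < c := by nlinarith
  have hx1 : 1 ≤ x := one_le_of_dominant hF (by linarith)
  rcases le_or_gt 0 y with hy | hy <;> rcases le_or_gt 0 z with hz | hz
  · rw [abs_of_nonneg hy, abs_of_nonneg hz] at hF
    refine ⟨?_, ?_, ?_⟩
    · by_contra h; push Not at h
      have hy0 : y = 0 := by linarith
      have hx : x = 1 := by linarith
      have hz2 : z ^ 2 = 1 := by rw [hy0, hx] at hu; linarith
      rcases eq_one_or_eq_neg_one_of_sq hz2 with hz1 | hz1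
      · rw [hx, hy0, hz1] at hdc; linarith
      · linarith
    · by_contra h; push Not at h
      have hz0 : z = 0 := by linarith
      have hx : x = 1 := by linarith
      have hy2 : y ^ 2 = 1 := by rw [hz0, hx] at hu; linarith
      rcases eq_one_or_eq_neg_one_of_sq hy2 with hy1 | hy1
      · rw [hx, hy1, hz0] at hdc; nlinarith
      · linarith
    · by_contra h; push Not at h
      have ha0 : a = 0 := by linarith
      have hb0 : b = 0 := by linarith
      rw [ha0, hb0] at hdc
      have : 1 < z := by nlinarith
      nlinarith
  · exfalso
    rw [abs_of_nonneg hy, abs_of_neg hz] at hF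
    have hyx : y ≤ x := by linarith
    have h2 : x ^ 2 + y ^ 2 ≤ 2 := by nlinarith
    have := weighted_le_of_sq_add_sq_le_two hab hyx h2 (by linarith)
    nlinarith
  · exfalso
    rw [abs_of_neg hy, abs_of_nonneg hz] at hF
    have hw : z ≤ x + y := by linarith
    have hw2 : (x + y) ^ 2 + z ^ 2 ≤ 2 := by nlinarith [mul_nonneg (show 0 ≤ x by linarith) (neg_nonneg.2 hy.le)]
    have h1 := weighted_le_of_sq_add_sq_le_two (le_trans hab hbc) hw hw2 (by linarith)
    have h2 : b * y ≤ a * y := by nlinarith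
    nlinarith
  · exfalso
    have h1 : b * y ≤ 0 := by nlinarith
    have h2 : c * z < 0 := by nlinarith
    have h3 := mul_le_add_of_sq_le_two ha (le_trans hab hbc) (show x ^ 2 ≤ 2 by nlinarith)
    linarith

set_option maxHeartbeats 400000 in
/-- Face `x ≤ −(|y| + |z|)` (the square about `−x`). -/
theorem spl2_sqNegX (hF : x ≤ -(|y| + |z|)) : 1 < y - x ∧ 1 < z - x ∧ a < b ∧ a < c := by
  have hc : 0 < c := by nlinarith
  have hx1 : x ≤ -1 := by
    have := one_le_of_dominant (show |y| + |z| ≤ -x by linarith) (by linarith : y ^ 2 + z ^ 2 + (-x) ^ 2 = 2)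
    linarith
  have hax : a * x ≤ 0 := by nlinarith
  rcases le_or_gt 0 y with hy | hy
  · rcases le_or_gt 0 z with hz | hz
    · rw [abs_of_nonneg hy, abs_of_nonneg hz] at hF
      have hab' : a < b := by
        by_contra h; push Not at h
        have hab'' : a = b := le_antisymm hab h
        rw [← hab''] at hdc
        have h1 : a * (x + y) ≤ 0 := by nlinarith
        have hz1 : 1 < z := by nlinarith
        nlinarith
      refine ⟨?_, ?_, hab', lt_of_lt_of_le hab' hbc⟩
      · by_contra h; push Not at h
        have hy0 : y = 0 := by linarith
        have hx : x = -1 := by linarith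
        have hz2 : z ^ 2 = 1 := by rw [hy0, hx] at hu; linarith
        rcases eq_one_or_eq_neg_one_of_sq hz2 with hz1 | hz1
        · rw [hx, hy0, hz1] at hdc; linarith
        · linarith
      · by_contra h; push Not at h
        have hz0 : z = 0 := by linarith
        have hx : x = -1 := by linarith
        have hy2 : y ^ 2 = 1 := by rw [hz0, hx] at hu; linarith
        rcases eq_one_or_eq_neg_one_of_sq hy2 with hy1 | hy1
        · rw [hx, hy1, hz0] at hdc; linarith
        · linarith
    · exfalso
      rw [abs_of_nonneg hy, abs_of_neg hz] at hF
      have hcz : c * z < 0 := by nlinarith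
      have h1 : c < b * y := by linarith
      have hb0 : 0 < b := by nlinarith
      have hy1 : 1 < y := by nlinarith
      nlinarith
  · exfalso
    have hby : b * y ≤ 0 := by nlinarith
    rcases le_or_gt 0 z with hz | hz
    · rw [abs_of_neg hy, abs_of_nonneg hz] at hF
      have hz1 : 1 < z := by nlinarith
      nlinarith
    · nlinarith

/-- Face `y ≤ −(|x| + |z|)` (the square about `−y`): too shallow. -/
theorem spl2_sqNegY (hF : y ≤ -(|x| + |z|)) : False := by
  have hc : 0 < c := by nlinarith
  have h0 : 0 ≤ |x| + |z| := by positivity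
  have hy2 : (|x| + |z|) ^ 2 ≤ y ^ 2 := by nlinarith
  have hxa : |x| ≤ 1 := by nlinarith [sq_abs x, sq_abs z, abs_nonneg x, abs_nonneg z]
  have hza : |z| ≤ 1 := by nlinarith [sq_abs x, sq_abs z, abs_nonneg x, abs_nonneg z]
  have h1 : a * x ≤ a := by nlinarith [le_abs_self x]
  have h2 : c * z ≤ c := by nlinarith [le_abs_self z]
  have h3 : b * y ≤ 0 := by nlinarith
  linarith

omit hu in
/-- Face `z ≤ −(|x| + |y|)` (the square about `−z`): too shallow. -/
theorem spl2_sqNegZ (hF : z ≤ -(|x| + |y|)) : False := by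
  have hc : 0 < c := by nlinarith
  have h1 : a * x + b * y ≤ b * (|x| + |y|) := by
    nlinarith [le_abs_self x, le_abs_self y, abs_nonneg x, abs_nonneg y]
  nlinarith [abs_nonneg x, abs_nonneg y]

set_option maxHeartbeats 400000 in
/-- The triangular faces with `z ≥ 0`. -/
theorem spl2_triPosZ (h1 : z < |x| + |y|) (h6 : y < |x| + |z|) (h7 : x < |y| + |z|)
    (h8 : -(|y| + |z|) < x) (h9 : -(|x| + |z|) < y) (hz : 0 ≤ z) :
    (1 < y + z ∧ 1 < x + z) ∨ (1 < y + z ∧ 1 < z - x ∧ a < c) ∨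
    (1 < x + z ∧ 1 < z - y ∧ b < c) ∨ (1 < z - x ∧ 1 < z - y ∧ a < c ∧ b < c) := by
  have hc : 0 < c := by nlinarith
  rw [abs_of_nonneg hz] at h6 h7 h8 h9
  rcases le_or_gt 0 x with hx | hx <;> rcases le_or_gt 0 y with hy | hy
  · left
    rw [abs_of_nonneg hy] at h7; rw [abs_of_nonneg hx] at h6
    exact ⟨one_lt_add_of_triangle hx hy hz h7 (by linarith), one_lt_add_of_triangle hy hx hz h6 (by linarith)⟩
  · -- x ≥ 0 > y: d₂, d₅
    rw [abs_of_nonneg hx, abs_of_neg hy] at h1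
    rw [abs_of_neg hy] at h7
    rw [abs_of_nonneg hx] at h9
    have hxz : 1 < x + z := one_lt_add_of_triangle (neg_nonneg.2 hy.le) hx hz (by linarith) (by linarith)
    have hzy : 1 < z - y := by
      have := one_lt_add_of_triangle hx (neg_nonneg.2 hy.le) hz (show x < -y + z by linarith) (by linarith)
      linarith
    rcases lt_or_eq_of_le hbc with hbc' | hbc'
    · right; right; left; exact ⟨hxz, hzy, hbc'⟩
    · exfalso
      rw [hbc'] at hdc
      rcases le_or_gt (z + y) 0 with hs | hs
      · have := mul_le_add_of_sq_le_two ha (le_trans hab hbc) (show x ^ 2 ≤ 2 by nlinarith)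
        nlinarith
      · have hsx : z + y ≤ x := by linarith
        have hs2 : x ^ 2 + (z + y) ^ 2 ≤ 2 := by nlinarith [mul_nonneg hz (neg_nonneg.2 hy.le)]
        have := weighted_le_of_sq_add_sq_le_two (le_trans hab hbc) hsx hs2 (by linarith)
        nlinarith
  · -- x < 0 ≤ y: d₁, d₄
    right; left
    rw [abs_of_neg hx] at h6
    rw [abs_of_nonneg hy] at h8
    refine ⟨one_lt_add_of_triangle (neg_nonneg.2 hx.le) hy hz (by linarith) (by linarith), ?_, ?_⟩
    · have := one_lt_add_of_triangle hy (neg_nonneg.2 hx.le) hz (show y < -x + z by linarith) (by linarith)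
      linarith
    · by_contra h; push Not at h
      have h2 := spl2_all_eq ha hab hbc hS hdc (le_antisymm (le_trans hab hbc) h)
      have hyz : y + z ≤ 2 := add_le_two_of_sq_add_sq_le_two (by nlinarith)
      linarith
  · -- x < 0, y < 0: d₄, d₅
    rw [abs_of_neg hx, abs_of_neg hy] at h1
    rw [abs_of_neg hy] at h8
    rw [abs_of_neg hx] at h9
    have hzx : 1 < z - x := by
      have := one_lt_add_of_triangle (neg_nonneg.2 hy.le) (neg_nonneg.2 hx.le) hz (show -y < -x + z by linarith) (by linarith)
      linarith
    have hzy : 1 < z - y := by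
      have := one_lt_add_of_triangle (neg_nonneg.2 hx.le) (neg_nonneg.2 hy.le) hz (show -x < -y + z by linarith) (by linarith)
      linarith
    have hac : a < c := by
      by_contra h; push Not at h
      have h2 := spl2_all_eq ha hab hbc hS hdc (le_antisymm (le_trans hab hbc) h)
      nlinarith
    rcases lt_or_eq_of_le hbc with hbc' | hbc'
    · right; right; right; exact ⟨hzx, hzy, hac, hbc'⟩
    · exfalso
      rw [hbc'] at hdc
      have hax : a * x ≤ 0 := by nlinarith
      have hs1 : 1 < z + y := by nlinarith
      -- s := z + y < -x and s² + x² ≤ 2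
      have hs2 : (z + y) ^ 2 + x ^ 2 ≤ 2 := by nlinarith [mul_nonneg hz (neg_nonneg.2 hy.le)]
      nlinarith

set_option maxHeartbeats 400000 in
/-- The triangular faces with `z < 0`: too shallow. -/
theorem spl2_triNegZ (h6 : y < |x| + |z|) (hz : z < 0) : False := by
  have hc : 0 < c := by nlinarith
  have hcz : c * z < 0 := by nlinarith
  rw [abs_of_neg hz] at h6
  rcases le_or_gt 0 x with hx | hx <;> rcases le_or_gt 0 y with hy | hy
  · rw [abs_of_nonneg hx] at h6
    -- s := y + z < x
    rcases le_or_gt (y + z) 0 with hs | hs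
    · have := mul_le_add_of_sq_le_two ha (le_trans hab hbc) (show x ^ 2 ≤ 2 by nlinarith)
      have : b * (y + z) ≤ 0 := by nlinarith
      nlinarith
    · have hsx : y + z ≤ x := by linarith
      have hs2 : x ^ 2 + (y + z) ^ 2 ≤ 2 := by nlinarith [mul_nonneg hy (neg_nonneg.2 hz.le)]
      have := weighted_le_of_sq_add_sq_le_two hab hsx hs2 (by linarith)
      nlinarith
  · have := mul_le_add_of_sq_le_two ha (le_trans hab hbc) (show x ^ 2 ≤ 2 by nlinarith)
    have : b * y ≤ 0 := by nlinarith
    nlinarith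
  · rw [abs_of_neg hx] at h6
    have hax : a * x ≤ 0 := by nlinarith
    rcases eq_or_lt_of_le (le_trans ha hab) with hb0 | hb0
    · rw [← hb0] at hdc; nlinarith
    · have hy1 : 1 - z < y := by nlinarith
      nlinarith
  · nlinarith

/-- **The single-point blocking lemma** (see the module docstring). -/
theorem spl2_coords (hne : ¬ (x = 0 ∧ y = 1 ∧ z = 1)) :
    (1 < y + z ∧ 1 < x + z) ∨
    (1 < y + z ∧ 1 < z - x ∧ a < c) ∨
    (1 < x + z ∧ 1 < z - y ∧ b < c) ∨
    (1 < z - x ∧ 1 < z - y ∧ a < c ∧ b < c) ∨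
    (1 < y + z ∧ 1 < x + y ∧ 0 < a + b) ∨
    (1 < y + z ∧ 1 < y - x ∧ a < b) ∨
    (1 < x + y ∧ 1 < x + z ∧ 0 < a + b) ∨
    (1 < y - x ∧ 1 < z - x ∧ a < b ∧ a < c) := by
  by_cases hF1 : |x| + |y| ≤ z
  · rcases spl2_sqPosZ ha hab hbc hS hu hdc hne hF1 with h | h | h | h
    · exact Or.inl h
    · exact Or.inr (Or.inl h)
    · exact Or.inr (Or.inr (Or.inl h))
    · exact Or.inr (Or.inr (Or.inr (Or.inl h)))
  by_cases hF6 : |x| + |z| ≤ y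
  · rcases spl2_sqPosY ha hab hbc hS hu hdc hne hF6 with h | h
    · exact Or.inr (Or.inr (Or.inr (Or.inr (Or.inl h))))
    · exact Or.inr (Or.inr (Or.inr (Or.inr (Or.inr (Or.inl h)))))
  by_cases hF7 : |y| + |z| ≤ x
  · exact Or.inr (Or.inr (Or.inr (Or.inr (Or.inr (Or.inr (Or.inl (spl2_sqPosX ha hab hbc hS hu hdc hF7)))))))
  by_cases hF8 : x ≤ -(|y| + |z|)
  · exact Or.inr (Or.inr (Or.inr (Or.inr (Or.inr (Or.inr (Or.inr (spl2_sqNegX ha hab hbc hS hu hdc hF8)))))))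
  by_cases hF9 : y ≤ -(|x| + |z|)
  · exact (spl2_sqNegY ha hab hbc hS hu hdc hF9).elim
  by_cases hF10 : z ≤ -(|x| + |y|)
  · exact (spl2_sqNegZ ha hab hbc hS hdc hF10).elim
  push Not at hF1 hF6 hF7 hF8 hF9 hF10
  rcases le_or_gt 0 z with hz | hz
  · rcases spl2_triPosZ ha hab hbc hS hu hdc hF1 hF6 hF7 hF8 hF9 hz with h | h | h | h
    · exact Or.inl h
    · exact Or.inr (Or.inl h)
    · exact Or.inr (Or.inr (Or.inl h))
    · exact Or.inr (Or.inr (Or.inr (Or.inl h)))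
  · exact (spl2_triNegZ ha hab hbc hS hu hdc hF6 hz).elim

end spl

end Summit.Ventures.Crystal3D.Theorems
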